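import Literature.Computability.Cryptography.RegevVerificationTest
import Literature.Computability.Cryptography.LWEProductLaws
import Literature.Computability.Cryptography.IndependentTrials
import HarnessLib

/-!
# Regev 2009, Lemmas 3.7 / 4.1 / 3.6 combined: solving for an `LWE` secret with an average-case oracle of unknown fit, by shifted attempts and verification — the idealised experiment and its failure bound

Topic `Computability/Cryptography` (family `pqc`), grouping namespace `Regev2009`; sequel of
`RegevVerificationTest.lean` (Lemma 3.6: the verification test and its two error bounds). Everything
here is PROVED (theorems, plus definitions WITH BODIES of the objects of the experiment); no named fact.

**What is formalised.** Inside Regev's classical reduction (Lemma 3.4 = Peikert 2009, Prop. 3.2,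
hypothesis `h₂` of `peikert_gapSVPZeta_to_lwe_classical_of_components`, pqc.S20) the secret `s` of the
manufactured `LWE` samples must be found using an oracle that is only guaranteed to work ON AVERAGE
over the secret (the `pqc` oracle format, success `≥ 2/3` for uniform `s`: Lemma 4.1's direction
"average-case ⇒ worst-case" by the shift `(a,b) ↦ (a, b + ⟨a,t⟩)`), only for ONE noise law among a
list of candidates (Lemma 3.7: the unknown `β ≤ α` is padded by extra noise of `K+1` trial magnitudes,
one of which fits), and whose answers must therefore be VERIFIED (Lemma 3.6). The algorithm: for each
block `j` (trial noise law `χO j`), draw a uniform shift `t`, query the oracle `F` on `m` shifted samples,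
un-shift the answer, and test the candidate on `N_V` fresh fine samples; output the first accepted
candidate. This file fixes that experiment at the level of LAWS (`PMF`s) — the ideal data of block `j`
being independent `t ∼ U(ℤ_qⁿ)`, `m` samples `A_{s,χO j}` and `N_V` fine samples `A^{(K)}_{s,χV}`
(`blockLaw`) — and proves the failure bound

  `Pr[output ≠ s] ≤ n_B · η_A + (1 - σ(1 - η_R))^{|T|}`      (`toReal_firstAccepted_ne_le`)

where `η_A` bounds the false-acceptance probability of the test `Acc` for every wrong candidate, `η_R`
its false-rejection probability for `s` (for the cosine test both from `RegevVerificationTest.lean`), and `σ` lower-bounds the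
AVERAGE-case success probability `searchSuccessProb (χO j) m F` of the oracle on every block `j` of a
set `T` of "fitting" blocks (for the reduction: the blocks run at the grid level of Lemma 3.7, where
`σ ≥ 2/3 - m·Δ(χO j, Ψ̄_α)`). What a bit-level proof must add is only that the machine's data law is
close to `indepLaw n_B blockLaw` (Lemma 3.11: `RegevBDDToLWESamples.lean`, `RegevBDDToLWESampleFine.lean`)
and that its decision is the function `firstAccepted` of the data.

## Objects (definitions with bodies)

* `blockLaw q K m N_V χO χV s` — the ideal law of one block `((t, batch), vbatch)`;
* `candidate F (t, batch) = F(shift_t batch) - t`; `Accepts F Acc d` (the block's verification batch lies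
  in the acceptance event `Acc (candidate)` of the verification test — for Regev's cosine test,
  `Acc c = acceptSet q K N_V θ c` of `RegevVerificationTest.lean`; a machine uses a rounded cosine, whence
  the abstraction); `firstAccepted F Acc D` (first accepted candidate along `Fin n_B`, `none` if no block
  accepts; `Fin.find`).

## Results

* `firstAccepted_ne_some` — the case analysis: a wrong output forces a FALSE ACCEPTANCE somewhere, or NO
  good block (accepted with the right candidate) anywhere;
* `toOuterMeasure_badAccept_le` — per block, `Pr[accept ∧ candidate ≠ s] ≤ η_A` (the verification batch
  is independent of the candidate);
* `toOuterMeasure_candidate_eq_searchSuccessProb` — per block, **`Pr[candidate = s] = searchSuccessProb`**,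
  the AVERAGE-case success probability of the oracle (Regev's shift: the shifted batch is `A_{s+t,χ}^m`,
  `lweSamples_map_shift`, and `s + t` is uniform);
* `toOuterMeasure_good_eq` — per block, `Pr[accept ∧ candidate = s] = Pr[candidate = s]·Pr[test accepts s]`;
* `toReal_firstAccepted_ne_le` — the displayed bound (union bound over blocks for false acceptances,
  product over the independent blocks of `T` for the absence of a good block).

## References

* O. Regev, *On lattices, learning with errors, random linear codes, and cryptography*, J. ACM 56
  (2009), art. 34 = arXiv:2401.03703: Lemma 3.6 (verification), Lemma 3.7 (unknown `β ≤ α`: "we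
  estimate … by applying `W` … if `s'` is accepted we output it"), Lemma 4.1 (proof: the shift
  `(a, b) ↦ (a, b + ⟨a, t⟩)`), §3.2.1 [RegevLWE2009].
* C. Peikert, *Public-key cryptosystems from the worst-case shortest vector problem*, STOC 2009,
  Prop. 3.2 ("Regev's Lemmas 3.5–3.7 … with non-negligible probability over uniform `s`") [Peikert2009].
-/

noncomputable section

open Finset
open scoped ENNReal

namespace Literature.Computability.Cryptography

namespace Regev2009

open Literature.Probability.Distributions Literature.Probability.Moments LWE

section Blocks

variable {ι : Type} [Fintype ι] [DecidableEq ι] (q K : ℕ) [NeZero q] (m NV : ℕ)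

/-- LOCAL GLUE. **The ideal law of one block of the experiment**: independently, a uniform shift
`t ∈ ℤ_qⁿ`, a batch of `m` coarse samples `A_{s,χO}^m` (for the oracle) and a batch of `N_V` fine
samples `A^{(K)}_{s,χV}` (for the verification test), as the independent pair `((t, batch), vbatch)`.
[cite: RegevLWE2009, Lemma 3.7 (proof) with Lemma 4.1 (proof) and Lemma 3.6] -/
def blockLaw (χO : PMF (ZMod q)) (χV : PMF (ZMod (q * K))) (s : ι → ZMod q) :
    PMF (((ι → ZMod q) × (Fin m → (ι → ZMod q) × ZMod q)) ×
      (Fin NV → (ι → ZMod q) × ZMod (q * K))) :=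
  prodLaw (prodLaw (PMF.uniformOfFintype (ι → ZMod q)) (lweSamples χO s m))
    (iidPMF (lweSampleK q K χV s) NV)

/-- LOCAL GLUE. **The candidate of a block**: query the oracle `F` on the batch shifted by `t`
(`(a, b) ↦ (a, b + ⟨a, t⟩)`, which turns `A_{s,χ}` into `A_{s+t,χ}`) and un-shift its answer.
[cite: RegevLWE2009, Lemma 4.1 (proof)] -/
def candidate (F : (Fin m → (ι → ZMod q) × ZMod q) → ι → ZMod q)
    (w : (ι → ZMod q) × (Fin m → (ι → ZMod q) × ZMod q)) : ι → ZMod q :=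
  F (shiftSample w.1 ∘ w.2) - w.1

/-- LOCAL GLUE. A block ACCEPTS when its verification batch lies in the acceptance event `Acc c` of the
verification test for its own candidate `c` (Regev's test: `Acc c = acceptSet q K N_V θ c`).
[cite: RegevLWE2009, Lemma 3.7 (proof: "we then use Lemma 3.6 to verify") with Lemma 3.6] -/
def Accepts (F : (Fin m → (ι → ZMod q) × ZMod q) → ι → ZMod q)
    (Acc : (ι → ZMod q) → Set (Fin NV → (ι → ZMod q) × ZMod (q * K)))
    (d : ((ι → ZMod q) × (Fin m → (ι → ZMod q) × ZMod q)) × (Fin NV → (ι → ZMod q) × ZMod (q * K))) :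
    Prop :=
  d.2 ∈ Acc (candidate q m F d.1)

open scoped Classical in
/-- LOCAL GLUE. **The output**: the candidate of the first accepting block along the block order, or
`none` ("if `s'` is accepted we output it; otherwise we continue with the next value").
[cite: RegevLWE2009, Lemma 3.7 (proof)] -/
def firstAccepted (F : (Fin m → (ι → ZMod q) × ZMod q) → ι → ZMod q)
    (Acc : (ι → ZMod q) → Set (Fin NV → (ι → ZMod q) × ZMod (q * K))) {nB : ℕ}
    (D : Fin nB → ((ι → ZMod q) × (Fin m → (ι → ZMod q) × ZMod q)) ×
      (Fin NV → (ι → ZMod q) × ZMod (q * K))) : Option (ι → ZMod q) :=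
  if h : ∃ j, Accepts q K m NV F Acc (D j) then some (candidate q m F (D (Fin.find _ h)).1) else none

variable {q K m NV}

omit [DecidableEq ι] [NeZero q] in
/-- **The case analysis.** If the output is not `some s` then either some block accepted a WRONG
candidate, or no block at all accepted the right one. [folklore] -/
theorem firstAccepted_ne_some {F : (Fin m → (ι → ZMod q) × ZMod q) → ι → ZMod q}
    {Acc : (ι → ZMod q) → Set (Fin NV → (ι → ZMod q) × ZMod (q * K))} {nB : ℕ}
    {D : Fin nB → ((ι → ZMod q) × (Fin m → (ι → ZMod q) × ZMod q)) ×
      (Fin NV → (ι → ZMod q) × ZMod (q * K))} {s : ι → ZMod q}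
    (h : firstAccepted q K m NV F Acc D ≠ some s) :
    (∃ j, Accepts q K m NV F Acc (D j) ∧ candidate q m F (D j).1 ≠ s) ∨
      ∀ j, ¬(Accepts q K m NV F Acc (D j) ∧ candidate q m F (D j).1 = s) := by
  classical
  unfold firstAccepted at h
  by_cases hex : ∃ j, Accepts q K m NV F Acc (D j)
  · rw [dif_pos hex] at h
    exact Or.inl ⟨Fin.find _ hex, Fin.find_spec hex, fun hc => h (by rw [hc])⟩
  · exact Or.inr fun j hj => hex ⟨j, hj.1⟩

/-! ### One block -/

/-- **False acceptance, per block.** If the test accepts every wrong candidate with probability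
`≤ η_A` (on `N_V` fine samples `A^{(K)}_{s,χV}`), then a block accepts a wrong candidate with
probability `≤ η_A` — its verification batch is independent of its candidate. [cite: RegevLWE2009, Lemma 3.6 with Lemma 3.7 (proof)] -/
theorem toOuterMeasure_badAccept_le (χO : PMF (ZMod q)) (χV : PMF (ZMod (q * K))) (s : ι → ZMod q)
    (F : (Fin m → (ι → ZMod q) × ZMod q) → ι → ZMod q)
    (Acc : (ι → ZMod q) → Set (Fin NV → (ι → ZMod q) × ZMod (q * K))) {ηA : ℝ≥0∞}
    (hA : ∀ c, c ≠ s → (iidPMF (lweSampleK q K χV s) NV).toOuterMeasure (Acc c) ≤ ηA) :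
    (blockLaw q K m NV χO χV s).toOuterMeasure
        {d | Accepts q K m NV F Acc d ∧ candidate q m F d.1 ≠ s} ≤ ηA := by
  refine toOuterMeasure_prodLaw_le _ _ _ fun w => ?_
  by_cases hc : candidate q m F w = s
  · have h0 : Prod.mk w ⁻¹' {d : ((ι → ZMod q) × (Fin m → (ι → ZMod q) × ZMod q)) ×
        (Fin NV → (ι → ZMod q) × ZMod (q * K)) | Accepts q K m NV F Acc d ∧ candidate q m F d.1 ≠ s} = ∅ := by
      ext V
      simp [hc]
    rw [h0, MeasureTheory.measure_empty]
    exact bot_le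
  · have h1 : Prod.mk w ⁻¹' {d : ((ι → ZMod q) × (Fin m → (ι → ZMod q) × ZMod q)) ×
        (Fin NV → (ι → ZMod q) × ZMod (q * K)) | Accepts q K m NV F Acc d ∧ candidate q m F d.1 ≠ s} =
        Acc (candidate q m F w) := by
      ext V
      simp [Accepts, hc]
    rw [h1]
    exact hA _ hc

/-- The success probability of the Dirac solver `pure ∘ F` against `s'` is the mass of `{F = s'}`.
[folklore] -/
theorem searchSuccessProbOf_pure (χ : PMF (ZMod q)) (F : (Fin m → (ι → ZMod q) × ZMod q) → ι → ZMod q)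
    (s' : ι → ZMod q) :
    searchSuccessProbOf χ m (fun B => PMF.pure (F B)) s' = (lweSamples χ s' m).toOuterMeasure {B | F B = s'} := by
  rw [searchSuccessProbOf, show (fun B => PMF.pure (F B)) = PMF.pure ∘ F from rfl, PMF.bind_pure_comp,
    ← PMF.toOuterMeasure_apply_singleton, PMF.toOuterMeasure_map_apply]
  rfl

/-- **Regev's shift, per block: `Pr[candidate = s]` is the AVERAGE-case success probability of the
oracle.** With `t` uniform and the batch `A_{s,χ}^m`, the shifted batch is `A_{s+t,χ}^m`
(`lweSamples_map_shift`) with `s + t` uniform, so `Pr_{t,batch}[F(shift_t batch) - t = s] =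
q⁻ⁿ ∑_{s'} Pr_{A_{s',χ}^m}[F = s'] = searchSuccessProb χ m F`. [cite: RegevLWE2009, Lemma 4.1 (proof)] -/
theorem toOuterMeasure_candidate_eq_searchSuccessProb (χ : PMF (ZMod q)) (s : ι → ZMod q)
    (F : (Fin m → (ι → ZMod q) × ZMod q) → ι → ZMod q) :
    (prodLaw (PMF.uniformOfFintype (ι → ZMod q)) (lweSamples χ s m)).toOuterMeasure
        {w | candidate q m F w = s} = searchSuccessProb χ m fun B => PMF.pure (F B) := by
  rw [toOuterMeasure_prodLaw_eq_tsum, searchSuccessProb, tsum_fintype]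
  -- reindex the average over the secret by `s' = s + t`
  rw [← Fintype.sum_equiv (Equiv.addLeft s)
    (fun t => PMF.uniformOfFintype (ι → ZMod q) (s + t) *
      searchSuccessProbOf χ m (fun B => PMF.pure (F B)) (s + t))
    (fun s' => PMF.uniformOfFintype (ι → ZMod q) s' * searchSuccessProbOf χ m (fun B => PMF.pure (F B)) s')
    (fun t => rfl)]
  refine Finset.sum_congr rfl fun t _ => ?_
  simp only [PMF.uniformOfFintype_apply]
  congr 1
  rw [searchSuccessProbOf_pure, ← lweSamples_map_shift χ s t m, PMF.toOuterMeasure_map_apply]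
  congr 1
  ext B
  simp only [Set.mem_preimage, Set.mem_setOf_eq, candidate]
  exact sub_eq_iff_eq_add

/-- **A good block, per block**: `Pr[accept ∧ candidate = s] = Pr[candidate = s] · Pr[test accepts s]`
(on the event `candidate = s` the acceptance event is the fixed event `Acc s` of the independent
verification batch). [cite: RegevLWE2009, Lemma 3.7 (proof) with Lemma 3.6] -/
theorem toOuterMeasure_good_eq (χO : PMF (ZMod q)) (χV : PMF (ZMod (q * K))) (s : ι → ZMod q)
    (F : (Fin m → (ι → ZMod q) × ZMod q) → ι → ZMod q)
    (Acc : (ι → ZMod q) → Set (Fin NV → (ι → ZMod q) × ZMod (q * K))) :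
    (blockLaw q K m NV χO χV s).toOuterMeasure {d | Accepts q K m NV F Acc d ∧ candidate q m F d.1 = s} =
      (searchSuccessProb χO m fun B => PMF.pure (F B)) *
        (iidPMF (lweSampleK q K χV s) NV).toOuterMeasure (Acc s) := by
  have hset : {d : ((ι → ZMod q) × (Fin m → (ι → ZMod q) × ZMod q)) ×
      (Fin NV → (ι → ZMod q) × ZMod (q * K)) | Accepts q K m NV F Acc d ∧ candidate q m F d.1 = s} =
      {w | candidate q m F w = s} ×ˢ Acc s := by
    ext ⟨w, V⟩
    simp only [Set.mem_setOf_eq, Set.mem_prod, Accepts]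
    constructor
    · rintro ⟨hA, hc⟩
      exact ⟨hc, hc ▸ hA⟩
    · rintro ⟨hc, hA⟩
      exact ⟨hc.symm ▸ hA, hc⟩
  rw [blockLaw, hset, toOuterMeasure_prodLaw_prod, toOuterMeasure_candidate_eq_searchSuccessProb]

/-! ### All blocks: the failure bound -/

/-- The real mass of a complement. [folklore] -/
theorem toReal_toOuterMeasure_compl' {α : Type} (p : PMF α) (S : Set α) :
    (p.toOuterMeasure Sᶜ).toReal = 1 - (p.toOuterMeasure S).toReal := by
  have h := congrArg ENNReal.toReal (toOuterMeasure_add_compl p S)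
  rw [ENNReal.toReal_add (pmf_toOuterMeasure_ne_top p S) (pmf_toOuterMeasure_ne_top p Sᶜ),
    ENNReal.toReal_one] at h
  linarith

/-- **Regev 2009, Lemmas 3.7 + 4.1 + 3.6 — the failure bound of the idealised experiment.** Blocks
`j < n_B` independent with laws `blockLaw (χO j) χV s`; the test accepts each wrong candidate with
probability `≤ η_A` and rejects `s` with probability `≤ η_R ≤ 1`; on the blocks of `T` the oracle's
average-case success probability is `≥ σ`. Then
`Pr[firstAccepted ≠ some s] ≤ n_B·η_A + (1 - σ(1 - η_R))^{|T|}`: a wrong output needs a false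
acceptance in some block (union bound) or the failure of every block of `T` (independence; a block of
`T` is good with probability `searchSuccessProb · Pr[accept s] ≥ σ(1 - η_R)`).
[cite: RegevLWE2009, Lemma 3.7 (proof) with Lemma 4.1 (proof) and Lemma 3.6] -/
theorem toReal_firstAccepted_ne_le {nB : ℕ} (χO : Fin nB → PMF (ZMod q)) (χV : PMF (ZMod (q * K)))
    (s : ι → ZMod q) (F : (Fin m → (ι → ZMod q) × ZMod q) → ι → ZMod q)
    (Acc : (ι → ZMod q) → Set (Fin NV → (ι → ZMod q) × ZMod (q * K))) {ηA ηR σ : ℝ}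
    (hηA : 0 ≤ ηA)
    (hA : ∀ c, c ≠ s → ((iidPMF (lweSampleK q K χV s) NV).toOuterMeasure (Acc c)).toReal ≤ ηA)
    (hR : ((iidPMF (lweSampleK q K χV s) NV).toOuterMeasure (Acc s)ᶜ).toReal ≤ ηR)
    (hηR : ηR ≤ 1) (T : Finset (Fin nB))
    (hσ : ∀ j ∈ T, σ ≤ (searchSuccessProb (χO j) m fun B => PMF.pure (F B)).toReal) :
    ((indepLaw nB fun j => blockLaw q K m NV (χO j) χV s).toOuterMeasure
        {D | firstAccepted q K m NV F Acc D ≠ some s}).toReal ≤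
      nB * ηA + (1 - σ * (1 - ηR)) ^ T.card := by
  classical
  -- abbreviations
  set P := indepLaw nB fun j => blockLaw q K m NV (χO j) χV s with hP
  set Bad : Set (((ι → ZMod q) × (Fin m → (ι → ZMod q) × ZMod q)) ×
      (Fin NV → (ι → ZMod q) × ZMod (q * K))) :=
    {d | Accepts q K m NV F Acc d ∧ candidate q m F d.1 ≠ s} with hBad
  set Good : Set (((ι → ZMod q) × (Fin m → (ι → ZMod q) × ZMod q)) ×
      (Fin NV → (ι → ZMod q) × ZMod (q * K))) :=
    {d | Accepts q K m NV F Acc d ∧ candidate q m F d.1 = s} with hGood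
  set VB := iidPMF (lweSampleK q K χV s) NV with hVB
  -- the two events
  set E1 : Set (Fin nB → _) := ⋃ j, {D | D j ∈ Bad} with hE1
  set E2 : Set (Fin nB → _) := {D | ∀ j, D j ∈ (if j ∈ T then Goodᶜ else Set.univ)} with hE2
  have hsub : {D | firstAccepted q K m NV F Acc D ≠ some s} ⊆ E1 ∪ E2 := by
    intro D hD
    rcases firstAccepted_ne_some hD with ⟨j, hj⟩ | hall
    · exact Or.inl (Set.mem_iUnion.2 ⟨j, hj⟩)
    · refine Or.inr fun j => ?_
      split_ifs
      · exact hall j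
      · exact Set.mem_univ _
  -- `Pr[E1] ≤ n_B η_A`
  have hA' : ∀ c, c ≠ s → VB.toOuterMeasure (Acc c) ≤ ENNReal.ofReal ηA := fun c hc => by
    rw [← ENNReal.ofReal_toReal (pmf_toOuterMeasure_ne_top VB _)]
    exact ENNReal.ofReal_le_ofReal (hA c hc)
  have h1 : (P.toOuterMeasure E1).toReal ≤ nB * ηA := by
    have hle : P.toOuterMeasure E1 ≤ ∑ j : Fin nB, ENNReal.ofReal ηA := by
      refine (MeasureTheory.measure_iUnion_fintype_le _ _).trans (sum_le_sum fun j _ => ?_)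
      rw [hP, indepLaw_toOuterMeasure_apply_preimage]
      exact toOuterMeasure_badAccept_le (χO j) χV s F Acc hA'
    have := ENNReal.toReal_mono (ENNReal.sum_ne_top.2 fun j _ => ENNReal.ofReal_ne_top) hle
    refine this.trans (le_of_eq ?_)
    rw [ENNReal.toReal_sum fun j _ => ENNReal.ofReal_ne_top, sum_const, card_univ, Fintype.card_fin,
      nsmul_eq_mul, ENNReal.toReal_ofReal hηA]
  -- `Pr[E2] ≤ (1 - σ(1 - η_R))^{|T|}`
  have hacc : 1 - ηR ≤ (VB.toOuterMeasure (Acc s)).toReal := by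
    have := toReal_toOuterMeasure_compl' VB (Acc s)
    linarith
  have hgood : ∀ j ∈ T, σ * (1 - ηR) ≤ ((blockLaw q K m NV (χO j) χV s).toOuterMeasure Good).toReal :=
    fun j hj => by
      rw [hGood, toOuterMeasure_good_eq, ENNReal.toReal_mul]
      exact mul_le_mul (hσ j hj) hacc (by linarith) ENNReal.toReal_nonneg
  have h2 : (P.toOuterMeasure E2).toReal ≤ (1 - σ * (1 - ηR)) ^ T.card := by
    rw [hE2, hP, toOuterMeasure_indepLaw_pi, ENNReal.toReal_prod]
    have hsplit : ∏ j, ((blockLaw q K m NV (χO j) χV s).toOuterMeasure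
        (if j ∈ T then Goodᶜ else Set.univ)).toReal =
        ∏ j ∈ T, ((blockLaw q K m NV (χO j) χV s).toOuterMeasure Goodᶜ).toReal := by
      rw [← prod_filter_mul_prod_filter_not univ (· ∈ T)]
      have hT : univ.filter (· ∈ T) = T := by ext j; simp
      have h1' : ∏ j ∈ univ.filter (fun j => ¬j ∈ T), ((blockLaw q K m NV (χO j) χV s).toOuterMeasure
          (if j ∈ T then Goodᶜ else Set.univ)).toReal = 1 :=
        prod_eq_one fun j hj => by
          rw [mem_filter] at hj
          rw [if_neg hj.2, (PMF.toOuterMeasure_apply_eq_one_iff _ _).2 (Set.subset_univ _), ENNReal.toReal_one]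
      rw [h1', mul_one, hT]
      exact prod_congr rfl fun j hj => by rw [if_pos hj]
    rw [hsplit]
    calc ∏ j ∈ T, ((blockLaw q K m NV (χO j) χV s).toOuterMeasure Goodᶜ).toReal
        ≤ ∏ _j ∈ T, (1 - σ * (1 - ηR)) :=
          prod_le_prod (fun j _ => ENNReal.toReal_nonneg) fun j hj => by
            rw [toReal_toOuterMeasure_compl']
            linarith [hgood j hj]
      _ = (1 - σ * (1 - ηR)) ^ T.card := prod_const _
  -- union bound
  calc (P.toOuterMeasure {D | firstAccepted q K m NV F Acc D ≠ some s}).toReal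
      ≤ (P.toOuterMeasure (E1 ∪ E2)).toReal :=
        ENNReal.toReal_mono (pmf_toOuterMeasure_ne_top _ _) (P.toOuterMeasure.mono hsub)
    _ ≤ (P.toOuterMeasure E1 + P.toOuterMeasure E2).toReal :=
        ENNReal.toReal_mono (ENNReal.add_ne_top.2 ⟨pmf_toOuterMeasure_ne_top _ _, pmf_toOuterMeasure_ne_top _ _⟩)
          (MeasureTheory.measure_union_le _ _)
    _ = (P.toOuterMeasure E1).toReal + (P.toOuterMeasure E2).toReal :=
        ENNReal.toReal_add (pmf_toOuterMeasure_ne_top _ _) (pmf_toOuterMeasure_ne_top _ _)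
    _ ≤ nB * ηA + (1 - σ * (1 - ηR)) ^ T.card := add_le_add h1 h2

end Blocks

end Regev2009

end Literature.Computability.Cryptography
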